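import Summits.BirchSwinnertonDyer.BirchSwinnertonDyer.Theorems.GenusKolyvaginAtTwoPowDvdShaCardAtTwoRTDeepOwnPrimeCondition
import Summits.BirchSwinnertonDyer.BirchSwinnertonDyer.Theorems.GenusKolyvaginAtTwoEquivariantKolyvaginExactAtTwoKolyvaginPrimeDictionary
import HarnessLib

/-!
# Route `GenusKolyvaginAtTwo`, LINE 18 (L_T `PowDvdShaCardAtTwoRT`, stmt-BirchSwinnertonDyer-23242), stub KS, bottom rung — the (V44)-socket
# `hTr` REDUCED to a K-side value statement: «`2 · [c₂(n′), τ] = 0` at the square `τ` of a ℚ-Frobenius of a deep own prime»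

LEAD seat `bsd-line-gk2-p1` g18 (cell `bsd-f1-sign2`), `--supports stmt-BirchSwinnertonDyer-23242` (helper; closes nothing).  THEOREMS ONLY; BSD
is not proved by any of this; neither is the crux, nor stub KS.

WHY (LEAD memo `Cruxes/PowDvdShaCardAtTwoRT/Lines/plus-descent-lead-g17.md` §10, `…-lead-g18.md` §3).  The bottom rung of KS (`hbot`, gk2-p5
`hbot_socket_margin`; LEAD g17 `exists_deep_notTwoDvd_of_witness_onHabitat`) displays ONE local socket at every deep own prime `ℓ` of a Kolyvagin
product `n′`: for a ℚ-class `Z` over `E[4]` with `res_K Z = c₂(n′)` and an arithmetic Frobenius `F` at a prime over `ℓ` acting on `E[4]` as a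
complex conjugation `c₀`:  **`hTr`: `∃ P₁, [2•Z, F] = F•P₁ − P₁`**.  This file reduces `hTr` to the VALUE statement **`2 • [Z, F·F] = 0`**
(pure cocycle algebra on the regular frame `E[4] = ℤP₀ ⊕ ℤ·c₀P₀` of `Δ < 0`), and then to the K-SIDE statement **`2 • [c, τ] = 0`** for a
`τ ∈ Γ_K` restricting to `F·F` (squares of `Γ_ℚ` lie in `res Γ_K` for `K` quadratic: `sq_mem_range_absGaloisRestrict_of_sq_eq`; the chosen
cocycles of `Z` and `res_K Z` agree at `τ` because `F·F` fixes `E[4]`: `h1Eval_resTorsion_eq`).  What remains for `hTr` is therefore the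
K-local fact «the Kolyvagin class kills the square of a ℚ-Frobenius at a deep own prime», which is Howard's Lemma 2.7.3 at `2`
(`JET.kolyvaginClass_mem_transverseKer_two`: `c₂(n′)` is TRANSVERSE at its own primes of index `≥ 3`) read at the element `F·F`, which acts trivially
on the ring class field `K[ℓ]` (`Gal(K[ℓ]/ℚ)` is generalised dihedral and `F ∉ Γ_K`) — the socket `hTrK` below, for a JET-fluent seat.
* `exists_eq_conj_smul_sub_of_add_conj_smul_eq_zero` — on a free `ℤ/4[c₀]`-line: `x + c₀x = 0 ⟹ x = c₀P₁ − P₁`;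
* `exists_h1Eval_two_nsmul_eq_smul_sub_of_sq` — **`hTr` at `(Z, F)` ⟸ `2 • [Z, F·F] = 0`** (cocycle identity `[Z, FF] = [Z,F] + F[Z,F]`, the
  coboundary ambiguity of `[2•Z, ·]` absorbed into `P₁`);
* `two_zsmul_h1Eval_sq_eq_zero_of_resTorsion` — `2 • [Z, F·F] = 0 ⟸ 2 • [res_K Z, τ] = 0` for any `τ ∈ Γ_K` over `F·F` fixing `E_K[4]`.
References: [McCallumLMS1991] §4 Prop. 4.4 (1), §5 proof of Prop. 5.2 (13); [GrossLMS1991] §9 (the pairing `[s, ρ]`);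
[Howard2004HeegnerKolyvagin] Lemma 2.7.3; [NeukirchANT1999] Ch. I §9.
-/

set_option autoImplicit false
set_option linter.dupNamespace false

noncomputable section

open scoped Classical

open Field NumberField IsDedekindDomain Function WeierstrassCurve
open Literature.NumberTheory.EllipticCurves Literature.NumberTheory.GaloisRepresentations

namespace Summit.BirchSwinnertonDyer.BirchSwinnertonDyer.Theorems.GenusExact.RelaxedCount

/-! ## §1 The regular frame: `ker (1 + c₀) ⊆ im (c₀ − 1)` on a free `ℤ/4[c₀]`-line -/

/-- **On a free rank-one `ℤ/2^M[c₀]`-module the kernel of `1 + c₀` is the image of `c₀ − 1`** (here `2^M = 4`, stated on `E[4]` with a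
displayed frame `P₀, c₀P₀`): if `x + c₀•x = 0` then `x = c₀•P₁ − P₁` for some `P₁`.  Proof: `x = aP₀ + b c₀P₀`, `x + c₀x = (a+b)(P₀ + c₀P₀)`
so `4 ∣ a + b` by freeness, and `x = −a·(c₀P₀ − P₀) + (a+b)c₀P₀ = c₀•(−aP₀) − (−aP₀)`. [cite: McCallumLMS1991, §5 Lemma 5.3] [cite: GrossLMS1991, §3 (3.3)] -/
theorem exists_eq_conj_smul_sub_of_add_conj_smul_eq_zero {W : WeierstrassCurve ℚ} {c₀ : absoluteGaloisGroup ℚ}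
    (hc₀ : ∀ P : geomTorsion W ((2 ^ 2 : ℕ) : ℤ), c₀ • c₀ • P = P) {P₀ : geomTorsion W ((2 ^ 2 : ℕ) : ℤ)}
    (hgen : ∀ Q : geomTorsion W ((2 ^ 2 : ℕ) : ℤ), ∃ a b : ℤ, Q = a • P₀ + b • c₀ • P₀)
    (hfree : ∀ a b : ℤ, a • P₀ + b • c₀ • P₀ = 0 → (4 : ℤ) ∣ a ∧ (4 : ℤ) ∣ b)
    {x : geomTorsion W ((2 ^ 2 : ℕ) : ℤ)} (hx : x + c₀ • x = 0) :
    ∃ P₁ : geomTorsion W ((2 ^ 2 : ℕ) : ℤ), x = c₀ • P₁ - P₁ := by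
  obtain ⟨a, b, hab⟩ := hgen x
  have h4 : ∀ Q : geomTorsion W ((2 ^ 2 : ℕ) : ℤ), (4 : ℤ) • Q = 0 := fun Q ↦ by
    have h := AddSubgroup.torsionBy.nsmul Q
    rw [← natCast_zsmul] at h
    exact_mod_cast h
  have hsum : (a + b) • P₀ + (a + b) • c₀ • P₀ = 0 := by
    have h := hx
    rw [hab, smul_add, smul_comm c₀ a P₀, smul_comm c₀ b (c₀ • P₀), hc₀] at h
    rw [← h, add_smul, add_smul]
    abel
  obtain ⟨⟨k, hk⟩, -⟩ := hfree (a + b) (a + b) hsum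
  refine ⟨-(a • P₀), ?_⟩
  have hb : b = 4 * k - a := by linarith
  rw [hab, hb, sub_smul, mul_smul, h4, zero_sub, smul_neg, smul_comm c₀ a P₀]
  abel

/-! ## §2 `hTr` at `(Z, F)` from `2 • [Z, F·F] = 0` -/

/-- **The (V44)-socket value from the vanishing of `2 • [Z, F·F]`.**  For a class `Z ∈ H¹(ℚ, E[4])`, an element `F ∈ Γ_ℚ` acting on `E[4]` as
the involution `c₀` of a regular frame (`E[4] = ℤP₀ ⊕ ℤ·c₀P₀` free over `ℤ/4`): if `2 • [Z, F·F] = 0` then `[2•Z, F] = F•P₁ − P₁` for some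
`P₁`.  The chosen cocycle `z` of `Z` satisfies `z(FF) = z(F) + F·z(F) = (1 + c₀) z(F)` (`h1Eval_mul_smul`), so `2z(F) ∈ ker(1 + c₀) =
im(c₀ − 1)` (§1); the chosen cocycle of `2•Z` differs from `2z` by a coboundary (`exists_h1Eval_add_eq`), absorbed into `P₁`.
[cite: McCallumLMS1991, §4 Prop. 4.4 (1)] [cite: GrossLMS1991, §9] -/
theorem exists_h1Eval_two_nsmul_eq_smul_sub_of_sq {W : WeierstrassCurve ℚ} {F c₀ : absoluteGaloisGroup ℚ}
    (hF : ∀ P : geomTorsion W ((2 ^ 2 : ℕ) : ℤ), F • P = c₀ • P)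
    (hc₀ : ∀ P : geomTorsion W ((2 ^ 2 : ℕ) : ℤ), c₀ • c₀ • P = P) {P₀ : geomTorsion W ((2 ^ 2 : ℕ) : ℤ)}
    (hgen : ∀ Q : geomTorsion W ((2 ^ 2 : ℕ) : ℤ), ∃ a b : ℤ, Q = a • P₀ + b • c₀ • P₀)
    (hfree : ∀ a b : ℤ, a • P₀ + b • c₀ • P₀ = 0 → (4 : ℤ) ∣ a ∧ (4 : ℤ) ∣ b)
    (Z : galH1Torsion W ((2 ^ 2 : ℕ) : ℤ)) (h2 : (2 : ℤ) • h1Eval W ((2 ^ 2 : ℕ) : ℤ) Z (F * F) = 0) :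
    ∃ P₁ : geomTorsion W ((2 ^ 2 : ℕ) : ℤ), h1Eval W _ ((2 : ℕ) • Z) F = F • P₁ - P₁ := by
  set x := h1Eval W ((2 ^ 2 : ℕ) : ℤ) Z F with hx_def
  -- the cocycle identity at `F·F`
  have hsq : h1Eval W ((2 ^ 2 : ℕ) : ℤ) Z (F * F) = x + c₀ • x := by
    rw [GenusExact.FrobeniusCriterion.h1Eval_mul_smul, ← hx_def, hF]
  have hker : (2 : ℤ) • x + c₀ • ((2 : ℤ) • x) = 0 := by
    rw [smul_comm c₀ (2 : ℤ) x, ← smul_add, ← hsq, h2]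
  obtain ⟨P₁, hP₁⟩ := exists_eq_conj_smul_sub_of_add_conj_smul_eq_zero hc₀ hgen hfree hker
  -- the chosen cocycle of `2 • Z = Z + Z` vs `2 z`
  obtain ⟨b, hb⟩ := GenusExact.DeepOwnPrime.exists_h1Eval_add_eq W ((2 ^ 2 : ℕ) : ℤ) Z Z F
  refine ⟨P₁ + b, ?_⟩
  rw [two_nsmul, hb, ← hx_def, ← two_zsmul, hP₁, smul_add]
  simp only [hF]
  abel

/-! ## §3 `2 • [Z, F·F] = 0` from the K-side value `2 • [res_K Z, τ] = 0` -/

/-- **Transfer of the socket to the K-side.**  If `τ ∈ Γ_K` restricts to `F·F` (`resGal τ = F·F`; for `K` quadratic every square of `Γ_ℚ` is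
such a restriction, `SelmerDescent.sq_mem_range_absGaloisRestrict_of_sq_eq`) and fixes `E_K[4]`, then `2 • [res_K Z, τ] = 0`
implies `2 • [Z, F·F] = 0`: the chosen cocycles of `res_K Z` and of `Z` agree at `τ` up to the injective coefficient map `θ`
(`h1Eval_resTorsion_eq`).  With `Z` descending `c₂(n′)` this is the (V44)-socket's K-side form «`2 • [c₂(n′), τ_{F²}] = 0`», i.e. Howard's
Lemma 2.7.3 at `2` (`JET.kolyvaginClass_mem_transverseKer_two`, own primes of index `≥ 3`) read at `F²`, which acts trivially on `K[ℓ]`.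
[cite: SerreGaloisCohomology1997, I §2.4] [cite: Howard2004HeegnerKolyvagin, Lemma 2.7.3] -/
theorem two_zsmul_h1Eval_sq_eq_zero_of_resTorsion {K : Type} [Field K] [NumberField K] {W : WeierstrassCurve ℚ} [W.IsElliptic]
    {F : absoluteGaloisGroup ℚ} (Z : galH1Torsion W ((2 ^ 2 : ℕ) : ℤ)) {τ : absoluteGaloisGroup K}
    (hτF : resGal (K := ℚ) K τ = F * F) (hτ : τ ∈ torsionFixing (W.baseChange K) ((2 ^ 2 : ℕ) : ℤ))
    (hK : (2 : ℤ) • h1Eval (W.baseChange K) ((2 ^ 2 : ℕ) : ℤ) (resTorsion W K ((2 ^ 2 : ℕ) : ℤ) Z) τ = 0) :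
    (2 : ℤ) • h1Eval W ((2 ^ 2 : ℕ) : ℤ) Z (F * F) = 0 := by
  have h := SelmerDescent.h1Eval_resTorsion_eq W K ((2 ^ 2 : ℕ) : ℤ) Z hτ
  rw [hτF] at h
  rw [h, ← map_zsmul] at hK
  exact (map_eq_zero_iff _ (torsionBaseChangeMap_injective W K _)).mp hK

end Summit.BirchSwinnertonDyer.BirchSwinnertonDyer.Theorems.GenusExact.RelaxedCount

end
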